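import Summits.AnomalousDissipation.AnomalousDissipation.Theorems.MarginalStabilityChainStrainedLayerLawClockReduction
import HarnessLib

/-!
# Crux `MarginalStabilityChain.StrainedLayerLaw` (stmt-AnomalousDissipation-3007), line `FirstLemmasR2K4`
# (log-enstrophy clock + Nash roundness): the vorticity centroid law — tools (slice identities, cutoff limits)

Support file (`--supports stmt-AnomalousDissipation-3007`; registered sub-goal `centroidLaw_sliceLimits`, the tools of
the registered sub-goal `vorticity_centroid_law` of line `FirstLemmasR2K4`, lead c7, wave 1). For one `C²`
divergence-free `L`-periodic slice `(u, v)` with shear tails `SliceTails C k u v` (`ω = ∂ₓv − ∂_yu`):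
* `∫∫ ωv = 0` over the period strip (`∫∫ (∂ₓv)v = 0` by periodicity; `∫∫ (∂_yu)v = −∫∫ (∂_yv)u = ∫∫ (∂ₓu)u = 0` by
  integration by parts across the layer and in `x`), `∫∫ ∂_yω = 0`, integrability of `yω`;
* the weight `ψ_R(y) = y σ(2 − y/R) σ(2 + y/R)` (`σ` = `Real.smoothTransition`): `C¹`, `= 0` for `|y| ≥ 2R`,
  `|ψ_R| ≤ min(|y|, 2R)`, `|ψ_R′| ≤ 1 + 4C_σ`, and `ψ_R(y) = y`, `ψ_R′(y) = 1` once `R > |y|`;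
* as `R → ∞` (dominated convergence on the strip): `∫∫ ωψ_R → ∫∫ yω`, `∫∫ ω(v − y)ψ_R′ → ∫∫ ω(v − y) = −∫∫ yω`,
  `∫∫ ∂_yω ψ_R′ → 0`, with the pointwise majorants reused for dominated convergence in time by the main file
  (`…ClockCentroidLaw.lean`: `M₁(t) = e^{−(t−s)}M₁(s)`, `M₁ = ∫∫ yω`).
All `[folklore]` (e.g. Majda–Bertozzi, *Vorticity and Incompressible Flow*, CUP 2002, §1.4).
-/

-- `Summit.<Summit>.<Problem>` is the tree's mandated summit-side namespace (CONVENTIONS §2); for this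
-- single-conjunct summit the two coincide, so the duplicate is deliberate.
set_option linter.dupNamespace false

noncomputable section

open scoped Topology ENNReal
open Filter Set Function MeasureTheory

namespace Summit.AnomalousDissipation.AnomalousDissipation.Theorems.StrainedLayerLaw.LogEnstrophyClock

open Literature.Analysis.FluidPDE Literature.Analysis.FluidPDE.StretchedLayer
open Summit.AnomalousDissipation.AnomalousDissipation.Theses.MarginalStabilityChain
open Summit.AnomalousDissipation.AnomalousDissipation.Theorems.StrainedLayerLaw.StrainWorkSumRule

/-! ## Slice identities: `∫∫ ωv = 0`, `∫∫ ∂_yω = 0`, integrability of `yω` -/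

section SliceFacts

variable {L C k : ℝ} {f g : ℝ → ℝ → ℝ}

/-- **`∫∫ ωv = 0` over the period strip** for a `C²` divergence-free `L`-periodic slice with shear tails:
`∫∫ (∂ₓv)v = 0` by periodicity, and `∫∫ (∂_yu)v = −∫∫ (∂_yv)u = ∫∫ (∂ₓu)u = 0` (integration by parts across the
layer with integrable products, then in `x` by periodicity). [folklore] -/
theorem centroidLaw_integral_vorticity_mul_v (hL : 0 < L) (hk : 0 < k) (hT : SliceTails C k f g)
    (hf : ContDiff ℝ 2 (fun q : ℝ × ℝ => f q.1 q.2)) (hg : ContDiff ℝ 2 (fun q : ℝ × ℝ => g q.1 q.2))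
    (hdiv : ∀ x y, dX f x y + dY g x y = 0) (hfper : ∀ x y, f (x + L) y = f x y)
    (hgper : ∀ x y, g (x + L) y = g x y) :
    ∫ q in Ioc 0 L ×ˢ univ, vorticity f g q.1 q.2 * g q.1 q.2 = 0 := by
  have hC : 0 ≤ C := hT.nonneg
  have hf1 : ContDiff ℝ 1 (fun q : ℝ × ℝ => f q.1 q.2) := hf.of_le one_le_two
  have hg1 : ContDiff ℝ 1 (fun q : ℝ × ℝ => g q.1 q.2) := hg.of_le one_le_two
  have cf : Continuous fun q : ℝ × ℝ => f q.1 q.2 := hf.continuous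
  have cg : Continuous fun q : ℝ × ℝ => g q.1 q.2 := hg.continuous
  have cfx := continuous_dX hf1
  have cfy := continuous_dY hf1
  have cgx := continuous_dX hg1
  have cgy := continuous_dY hg1
  have hfB : ∀ x y, |f x y| ≤ 1 + C := hT.abs_u_le hk
  have hgB : ∀ x y, |g x y| ≤ C := hT.abs_v_le_const hk
  -- integrability of the products on the strip
  have i1 : IntegrableOn (fun q : ℝ × ℝ => g q.1 q.2 * dX g q.1 q.2) (Ioc 0 L ×ˢ univ) :=
    integrableOn_strip_bdd_mul_decay hk cg cgx hgB hC hT.abs_dX_v_le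
  have i2 : IntegrableOn (fun q : ℝ × ℝ => dX g q.1 q.2 * g q.1 q.2) (Ioc 0 L ×ˢ univ) :=
    integrableOn_strip_decay_mul_bdd hk cg cgx hgB hC hT.abs_dX_v_le
  have i3 : IntegrableOn (fun q : ℝ × ℝ => f q.1 q.2 * dY g q.1 q.2) (Ioc 0 L ×ˢ univ) :=
    integrableOn_strip_bdd_mul_decay hk cf cgy hfB hC hT.abs_dY_v_le
  have i4 : IntegrableOn (fun q : ℝ × ℝ => dY f q.1 q.2 * g q.1 q.2) (Ioc 0 L ×ˢ univ) :=
    integrableOn_strip_decay_mul_bdd hk cg cfy hgB hC hT.abs_dY_u_le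
  have i5 : IntegrableOn (fun q : ℝ × ℝ => f q.1 q.2 * g q.1 q.2) (Ioc 0 L ×ˢ univ) :=
    integrableOn_strip_bdd_mul_decay hk cf cg hfB hC hT.abs_v_le
  have i6 : IntegrableOn (fun q : ℝ × ℝ => f q.1 q.2 * dX f q.1 q.2) (Ioc 0 L ×ˢ univ) :=
    integrableOn_strip_bdd_mul_decay hk cf cfx hfB hC hT.abs_dX_u_le
  have i7 : IntegrableOn (fun q : ℝ × ℝ => dX f q.1 q.2 * f q.1 q.2) (Ioc 0 L ×ˢ univ) :=
    integrableOn_strip_decay_mul_bdd hk cf cfx hfB hC hT.abs_dX_u_le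
  -- (i) `∫∫ (∂ₓv) v = 0` by periodicity
  have e1 : ∫ q in Ioc 0 L ×ˢ univ, g q.1 q.2 * dX g q.1 q.2 =
      -∫ q in Ioc 0 L ×ˢ univ, dX g q.1 q.2 * g q.1 q.2 := by
    refine integral_strip_mul_dX_eq_neg hL.le (hasDerivAt_dX_of_contDiff hg two_ne_zero)
      (hasDerivAt_dX_of_contDiff hg two_ne_zero) (continuous_slice_x cgx) (continuous_slice_x cgx)
      (fun y => ?_) i1 i2
    rw [show g L y = g 0 y by simpa using hgper 0 y]
  have e1' : ∫ q in Ioc 0 L ×ˢ univ, dX g q.1 q.2 * g q.1 q.2 =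
      ∫ q in Ioc 0 L ×ˢ univ, g q.1 q.2 * dX g q.1 q.2 :=
    integral_congr_ae (Eventually.of_forall fun q => mul_comm _ _)
  have hX : ∫ q in Ioc 0 L ×ˢ univ, dX g q.1 q.2 * g q.1 q.2 = 0 := by linarith
  -- (ii) `∫∫ (∂_yu) v = −∫∫ u ∂_yv = ∫∫ u ∂ₓu = 0`
  have e2 : ∫ q in Ioc 0 L ×ˢ univ, f q.1 q.2 * dY g q.1 q.2 =
      -∫ q in Ioc 0 L ×ˢ univ, dY f q.1 q.2 * g q.1 q.2 :=
    integral_strip_mul_dY_eq_neg (hasDerivAt_dY_of_contDiff hf two_ne_zero)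
      (hasDerivAt_dY_of_contDiff hg two_ne_zero) i3 i4 i5
  have e3 : ∫ q in Ioc 0 L ×ˢ univ, f q.1 q.2 * dY g q.1 q.2 =
      -∫ q in Ioc 0 L ×ˢ univ, f q.1 q.2 * dX f q.1 q.2 := by
    rw [← integral_neg]
    refine integral_congr_ae (Eventually.of_forall fun q => ?_)
    have h := hdiv q.1 q.2
    simp only
    rw [show dY g q.1 q.2 = -dX f q.1 q.2 by linarith]
    ring
  have e4 : ∫ q in Ioc 0 L ×ˢ univ, f q.1 q.2 * dX f q.1 q.2 =
      -∫ q in Ioc 0 L ×ˢ univ, dX f q.1 q.2 * f q.1 q.2 := by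
    refine integral_strip_mul_dX_eq_neg hL.le (hasDerivAt_dX_of_contDiff hf two_ne_zero)
      (hasDerivAt_dX_of_contDiff hf two_ne_zero) (continuous_slice_x cfx) (continuous_slice_x cfx)
      (fun y => ?_) i6 i7
    rw [show f L y = f 0 y by simpa using hfper 0 y]
  have e4' : ∫ q in Ioc 0 L ×ˢ univ, dX f q.1 q.2 * f q.1 q.2 =
      ∫ q in Ioc 0 L ×ˢ univ, f q.1 q.2 * dX f q.1 q.2 :=
    integral_congr_ae (Eventually.of_forall fun q => mul_comm _ _)
  have hY : ∫ q in Ioc 0 L ×ˢ univ, dY f q.1 q.2 * g q.1 q.2 = 0 := by linarith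
  -- assemble `∫∫ ωv = ∫∫ (∂ₓv) v − ∫∫ (∂_yu) v`
  calc ∫ q in Ioc 0 L ×ˢ univ, vorticity f g q.1 q.2 * g q.1 q.2
      = (∫ q in Ioc 0 L ×ˢ univ, dX g q.1 q.2 * g q.1 q.2) - ∫ q in Ioc 0 L ×ˢ univ, dY f q.1 q.2 * g q.1 q.2 := by
        rw [← integral_sub i2 i4]
        exact integral_congr_ae (Eventually.of_forall fun q => by simp only [StrainWorkSumRule.vorticity]; ring)
    _ = 0 := by rw [hX, hY, sub_zero]

/-- **`∫∫ ∂_yω = 0` over the period strip** for a `C²` divergence-free slice with shear tails (`ω → 0` across the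
layer: integration by parts in `y` against the constant `1`, `|ω|, |∂_yω| ≤ Ce^{−k|y|}`). [folklore] -/
theorem centroidLaw_integral_dY_vorticity (hk : 0 < k) (hT : SliceTails C k f g)
    (hf : ContDiff ℝ 2 (fun q : ℝ × ℝ => f q.1 q.2)) (hg : ContDiff ℝ 2 (fun q : ℝ × ℝ => g q.1 q.2))
    (hdiv : ∀ x y, dX f x y + dY g x y = 0) :
    ∫ q in Ioc 0 L ×ˢ univ, dY (vorticity f g) q.1 q.2 = 0 := by
  have hC : 0 ≤ C := hT.nonneg
  have hω1 : ContDiff ℝ 1 (fun q : ℝ × ℝ => vorticity f g q.1 q.2) := contDiff_one_vorticity hf hg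
  have cω : Continuous fun q : ℝ × ℝ => vorticity f g q.1 q.2 := hω1.continuous
  have cωy : Continuous fun q : ℝ × ℝ => dY (vorticity f g) q.1 q.2 := continuous_dY hω1
  have i1 : IntegrableOn (fun q : ℝ × ℝ => (1:ℝ) * dY (vorticity f g) q.1 q.2) (Ioc 0 L ×ˢ univ) :=
    integrableOn_strip_bdd_mul_decay (K := fun _ _ => (1:ℝ)) (A := 1) hk continuous_const cωy
      (fun _ _ => by norm_num) hC (kato_abs_dY_vorticity_le hT hf hg hdiv)
  have i2 : IntegrableOn (fun q : ℝ × ℝ => (0:ℝ) * vorticity f g q.1 q.2) (Ioc 0 L ×ˢ univ) := by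
    simpa only [zero_mul] using integrableOn_zero
  have i3 : IntegrableOn (fun q : ℝ × ℝ => (1:ℝ) * vorticity f g q.1 q.2) (Ioc 0 L ×ˢ univ) :=
    integrableOn_strip_bdd_mul_decay (K := fun _ _ => (1:ℝ)) (A := 1) hk continuous_const cω
      (fun _ _ => by norm_num) hC (tails_abs_vorticity_le hT)
  have h := integral_strip_mul_dY_eq_neg (L := L) (f := fun _ _ => (1:ℝ)) (g := vorticity f g)
    (f' := fun _ _ => (0:ℝ)) (g' := dY (vorticity f g)) (fun _ y => hasDerivAt_const y (1:ℝ))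
    (hasDerivAt_dY_of_contDiff hω1 one_ne_zero) i1 i2 i3
  simpa using h

/-- The first moment density `yω` is integrable on the period strip under shear tails
(`|yω| ≤ C|y|e^{−k|y|} ≤ C(1 + |y|)²e^{−k|y|}`). [folklore] -/
theorem centroidLaw_integrableOn_moment (hk : 0 < k) (hT : SliceTails C k f g)
    (hf : ContDiff ℝ 2 (fun q : ℝ × ℝ => f q.1 q.2)) (hg : ContDiff ℝ 2 (fun q : ℝ × ℝ => g q.1 q.2)) :
    IntegrableOn (fun q : ℝ × ℝ => q.2 * vorticity f g q.1 q.2) (Ioc 0 L ×ˢ univ) := by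
  have hC : 0 ≤ C := hT.nonneg
  have cω : Continuous fun q : ℝ × ℝ => vorticity f g q.1 q.2 := (contDiff_one_vorticity hf hg).continuous
  refine integrableOn_strip_of_abs_le_sq_exp (C := C) (continuous_snd.mul cω) hk fun x _ y => ?_
  rw [abs_mul]
  calc |y| * |vorticity f g x y| ≤ |y| * (C * Real.exp (-k * |y|)) :=
        mul_le_mul_of_nonneg_left (tails_abs_vorticity_le hT x y) (abs_nonneg y)
    _ = C * (|y| * Real.exp (-k * |y|)) := by ring
    _ ≤ C * ((1 + |y|) ^ 2 * Real.exp (-k * |y|)) :=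
        mul_le_mul_of_nonneg_left (abs_mul_exp_le_one_add_abs_sq_mul_exp k y) hC

end SliceFacts

/-! ## The weight `ψ_R(y) = y σ(2 − y/R) σ(2 + y/R)` -/

section Weight

variable {R : ℝ}

/-- `ψ_R` is `C¹`. [folklore] -/
theorem centroidLaw_weight_contDiff (R : ℝ) :
    ContDiff ℝ 1 (fun y : ℝ => y * (Real.smoothTransition (2 - y / R) * Real.smoothTransition (2 + y / R))) :=
  contDiff_id.mul (kato_cutoff_contDiff R)

/-- `ψ_R(y) = 0` for `|y| ≥ 2R` (`R > 0`). [folklore] -/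
theorem centroidLaw_weight_eq_zero (hR : 0 < R) {y : ℝ} (hy : 2 * R ≤ |y|) :
    y * (Real.smoothTransition (2 - y / R) * Real.smoothTransition (2 + y / R)) = 0 := by
  rw [kato_cutoff_eq_zero hR hy, mul_zero]

/-- `|ψ_R(y)| ≤ |y|`. [folklore] -/
theorem centroidLaw_weight_abs_le (R y : ℝ) :
    |y * (Real.smoothTransition (2 - y / R) * Real.smoothTransition (2 + y / R))| ≤ |y| := by
  rw [abs_mul]
  exact mul_le_of_le_one_right (abs_nonneg _) (kato_cutoff_abs_le_one R y)

/-- `|ψ_R(y)| ≤ 2R` (`R > 0`). [folklore] -/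
theorem centroidLaw_weight_abs_le_two_mul (hR : 0 < R) (y : ℝ) :
    |y * (Real.smoothTransition (2 - y / R) * Real.smoothTransition (2 + y / R))| ≤ 2 * R := by
  by_cases hy : 2 * R ≤ |y|
  · rw [centroidLaw_weight_eq_zero hR hy, abs_zero]; positivity
  · exact (centroidLaw_weight_abs_le R y).trans (not_le.1 hy).le

/-- `ψ_R′(y) = σσ(y) + y (σσ)′(y)` (product rule; `σσ` the cutoff). [folklore] -/
theorem centroidLaw_weight_deriv (R y : ℝ) :
    deriv (fun y : ℝ => y * (Real.smoothTransition (2 - y / R) * Real.smoothTransition (2 + y / R))) y =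
      Real.smoothTransition (2 - y / R) * Real.smoothTransition (2 + y / R) +
        y * deriv (fun y : ℝ => Real.smoothTransition (2 - y / R) * Real.smoothTransition (2 + y / R)) y := by
  have h := (hasDerivAt_id' y).mul ((kato_cutoff_contDiff R).differentiable one_ne_zero y).hasDerivAt
  rw [one_mul] at h
  exact h.deriv

/-- `ψ_R′(y) = 0` for `|y| > 2R` (`R > 0`). [folklore] -/
theorem centroidLaw_weight_deriv_eq_zero (hR : 0 < R) {y : ℝ} (hy : 2 * R < |y|) :
    deriv (fun y : ℝ => y * (Real.smoothTransition (2 - y / R) * Real.smoothTransition (2 + y / R))) y = 0 := by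
  rw [centroidLaw_weight_deriv, kato_cutoff_eq_zero hR hy.le, kato_cutoff_deriv_eq_zero_of_gt hR hy, mul_zero,
    add_zero]

/-- `|ψ_R′| ≤ 1 + 4C_σ` (`R > 0`; `|(σσ)′| ≤ 2C_σ/R` is supported in `|y| ≤ 2R`). [folklore] -/
theorem centroidLaw_weight_deriv_abs_le (hR : 0 < R) {Cσ : ℝ} (hCσ0 : 0 ≤ Cσ)
    (hCσ : ∀ x, |deriv Real.smoothTransition x| ≤ Cσ) (y : ℝ) :
    |deriv (fun y : ℝ => y * (Real.smoothTransition (2 - y / R) * Real.smoothTransition (2 + y / R))) y| ≤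
      1 + 4 * Cσ := by
  rw [centroidLaw_weight_deriv]
  refine (abs_add_le _ _).trans (add_le_add (kato_cutoff_abs_le_one R y) ?_)
  rw [abs_mul]
  by_cases hy : 2 * R < |y|
  · rw [kato_cutoff_deriv_eq_zero_of_gt hR hy, abs_zero, mul_zero]; positivity
  · have h1 := kato_cutoff_deriv_bound hR hCσ y
    have h2 : |y| ≤ 2 * R := not_lt.1 hy
    calc |y| * |deriv (fun y : ℝ => Real.smoothTransition (2 - y / R) * Real.smoothTransition (2 + y / R)) y|
        ≤ 2 * R * (2 * Cσ / R) := mul_le_mul h2 h1 (abs_nonneg _) (by positivity)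
      _ = 4 * Cσ := by
          rw [show 2 * R * (2 * Cσ / R) = 2 * (2 * Cσ / R * R) by ring, div_mul_cancel₀ _ hR.ne']
          ring

/-- Eventually in `R → ∞`: `ψ_R(y) = y` and `ψ_R′(y) = 1` (once `R > |y|`). [folklore] -/
theorem centroidLaw_weight_eventually (y : ℝ) : ∀ᶠ R : ℝ in atTop,
    y * (Real.smoothTransition (2 - y / R) * Real.smoothTransition (2 + y / R)) = y ∧
    deriv (fun y : ℝ => y * (Real.smoothTransition (2 - y / R) * Real.smoothTransition (2 + y / R))) y = 1 := by
  filter_upwards [eventually_gt_atTop |y|] with R hR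
  have hR0 : 0 < R := (abs_nonneg y).trans_lt hR
  refine ⟨by rw [kato_cutoff_eq_one hR0 hR.le, mul_one], ?_⟩
  rw [centroidLaw_weight_deriv, kato_cutoff_eq_one hR0 hR.le, kato_cutoff_deriv_eq_zero_of_lt hR0 hR, mul_zero,
    add_zero]

end Weight

/-! ## The limits `R → ∞` at one instant -/

section Limits

variable {L C k : ℝ} {f g : ℝ → ℝ → ℝ}

/-- `|ωψ_R| ≤ C(C + |y|)e^{−k|y|}`. [folklore] -/
theorem centroidLaw_N_bound (hT : SliceTails C k f g) (R : ℝ) (q : ℝ × ℝ) :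
    |vorticity f g q.1 q.2 * (q.2 * (Real.smoothTransition (2 - q.2 / R) * Real.smoothTransition (2 + q.2 / R)))| ≤
      C * ((C + |q.2|) * Real.exp (-k * |q.2|)) := by
  have hC : 0 ≤ C := hT.nonneg
  rw [abs_mul]
  calc _ ≤ C * Real.exp (-k * |q.2|) * |q.2| := mul_le_mul (tails_abs_vorticity_le hT q.1 q.2)
        (centroidLaw_weight_abs_le R q.2) (abs_nonneg _) (by positivity)
    _ ≤ C * Real.exp (-k * |q.2|) * |q.2| + C * C * Real.exp (-k * |q.2|) := le_add_of_nonneg_right (by positivity)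
    _ = C * ((C + |q.2|) * Real.exp (-k * |q.2|)) := by ring

/-- `|ω(v − y)ψ_R′| ≤ (1 + 4C_σ)C(C + |y|)e^{−k|y|}` (`R > 0`). [folklore] -/
theorem centroidLaw_B_bound (hk : 0 < k) (hT : SliceTails C k f g) {R : ℝ} (hR : 0 < R) {Cσ : ℝ} (hCσ0 : 0 ≤ Cσ)
    (hCσ : ∀ x, |deriv Real.smoothTransition x| ≤ Cσ) (q : ℝ × ℝ) :
    |vorticity f g q.1 q.2 * (g q.1 q.2 - q.2) *
        deriv (fun y : ℝ => y * (Real.smoothTransition (2 - y / R) * Real.smoothTransition (2 + y / R))) q.2| ≤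
      (1 + 4 * Cσ) * (C * ((C + |q.2|) * Real.exp (-k * |q.2|))) := by
  have hC : 0 ≤ C := hT.nonneg
  have h1 := tails_abs_vorticity_le hT q.1 q.2
  have h2 : |g q.1 q.2 - q.2| ≤ C + |q.2| :=
    (abs_sub _ _).trans (add_le_add_left (hT.abs_v_le_const hk q.1 q.2) _)
  have h3 := centroidLaw_weight_deriv_abs_le hR hCσ0 hCσ q.2
  rw [abs_mul, abs_mul]
  calc _ ≤ C * Real.exp (-k * |q.2|) * (C + |q.2|) * (1 + 4 * Cσ) :=
        mul_le_mul (mul_le_mul h1 h2 (abs_nonneg _) (by positivity)) h3 (abs_nonneg _) (by positivity)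
    _ = (1 + 4 * Cσ) * (C * ((C + |q.2|) * Real.exp (-k * |q.2|))) := by ring

/-- `|∂_yω ψ_R′| ≤ (1 + 4C_σ)Ce^{−k|y|}` (`R > 0`). [folklore] -/
theorem centroidLaw_E_bound (hT : SliceTails C k f g) (hf : ContDiff ℝ 2 (fun q : ℝ × ℝ => f q.1 q.2))
    (hg : ContDiff ℝ 2 (fun q : ℝ × ℝ => g q.1 q.2)) (hdiv : ∀ x y, dX f x y + dY g x y = 0)
    {R : ℝ} (hR : 0 < R) {Cσ : ℝ} (hCσ0 : 0 ≤ Cσ) (hCσ : ∀ x, |deriv Real.smoothTransition x| ≤ Cσ) (q : ℝ × ℝ) :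
    |1 * dY (vorticity f g) q.1 q.2 *
        deriv (fun y : ℝ => y * (Real.smoothTransition (2 - y / R) * Real.smoothTransition (2 + y / R))) q.2| ≤
      (1 + 4 * Cσ) * (C * Real.exp (-k * |q.2|)) := by
  have hC : 0 ≤ C := hT.nonneg
  rw [one_mul, abs_mul]
  calc _ ≤ C * Real.exp (-k * |q.2|) * (1 + 4 * Cσ) := mul_le_mul (kato_abs_dY_vorticity_le hT hf hg hdiv q.1 q.2)
        (centroidLaw_weight_deriv_abs_le hR hCσ0 hCσ q.2) (abs_nonneg _) (by positivity)
    _ = (1 + 4 * Cσ) * (C * Real.exp (-k * |q.2|)) := by ring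

/-- **`N_R = ∫∫ ωψ_R → ∫∫ yω`** as `R → ∞` (dominated convergence, `ψ_R(y) = y` once `R > |y|`). [folklore] -/
theorem centroidLaw_limit_N (hk : 0 < k) (hT : SliceTails C k f g) (hf : ContDiff ℝ 2 (fun q : ℝ × ℝ => f q.1 q.2))
    (hg : ContDiff ℝ 2 (fun q : ℝ × ℝ => g q.1 q.2)) :
    Tendsto (fun R : ℝ => ∫ q in Ioc 0 L ×ˢ univ, vorticity f g q.1 q.2 *
      (q.2 * (Real.smoothTransition (2 - q.2 / R) * Real.smoothTransition (2 + q.2 / R)))) atTop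
      (𝓝 (∫ q in Ioc 0 L ×ˢ univ, q.2 * vorticity f g q.1 q.2)) := by
  have hC : 0 ≤ C := hT.nonneg
  have cω : Continuous fun q : ℝ × ℝ => vorticity f g q.1 q.2 := (contDiff_one_vorticity hf hg).continuous
  refine tendsto_integral_filter_of_dominated_convergence (fun q => C * ((C + |q.2|) * Real.exp (-k * |q.2|)))
    ?_ ?_ ?_ ?_
  · exact Eventually.of_forall fun R =>
      (cω.mul ((centroidLaw_weight_contDiff R).continuous.comp continuous_snd)).aestronglyMeasurable
  · exact Eventually.of_forall fun R => Eventually.of_forall fun q => by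
      rw [Real.norm_eq_abs]; exact centroidLaw_N_bound hT R q
  · exact (kato_integrableOn_weight' hk hC L).const_mul C
  · refine Eventually.of_forall fun q => tendsto_const_nhds.congr' ?_
    filter_upwards [centroidLaw_weight_eventually q.2] with R hR
    rw [hR.1, mul_comm]

/-- **`B_R = ∫∫ ω(v − y)ψ_R′ → ∫∫ ω(v − y) = −∫∫ yω`** as `R → ∞` (dominated convergence with `ψ_R′ → 1`,
`|ψ_R′| ≤ 1 + 4C_σ`; `∫∫ ωv = 0`). [folklore] -/
theorem centroidLaw_limit_B (hL : 0 < L) (hk : 0 < k) (hT : SliceTails C k f g)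
    (hf : ContDiff ℝ 2 (fun q : ℝ × ℝ => f q.1 q.2)) (hg : ContDiff ℝ 2 (fun q : ℝ × ℝ => g q.1 q.2))
    (hdiv : ∀ x y, dX f x y + dY g x y = 0) (hfper : ∀ x y, f (x + L) y = f x y)
    (hgper : ∀ x y, g (x + L) y = g x y) {Cσ : ℝ} (hCσ0 : 0 ≤ Cσ)
    (hCσ : ∀ x, |deriv Real.smoothTransition x| ≤ Cσ) :
    Tendsto (fun R : ℝ => ∫ q in Ioc 0 L ×ˢ univ, vorticity f g q.1 q.2 * (g q.1 q.2 - q.2) *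
      deriv (fun y : ℝ => y * (Real.smoothTransition (2 - y / R) * Real.smoothTransition (2 + y / R))) q.2) atTop
      (𝓝 (-∫ q in Ioc 0 L ×ˢ univ, q.2 * vorticity f g q.1 q.2)) := by
  have hC : 0 ≤ C := hT.nonneg
  have cω : Continuous fun q : ℝ × ℝ => vorticity f g q.1 q.2 := (contDiff_one_vorticity hf hg).continuous
  have cg : Continuous fun q : ℝ × ℝ => g q.1 q.2 := hg.continuous
  -- the limit integral
  have i1 : IntegrableOn (fun q : ℝ × ℝ => vorticity f g q.1 q.2 * g q.1 q.2) (Ioc 0 L ×ˢ univ) :=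
    integrableOn_strip_decay_mul_bdd hk cg cω (hT.abs_v_le_const hk) hC (tails_abs_vorticity_le hT)
  have i2 := centroidLaw_integrableOn_moment (L := L) hk hT hf hg
  have e : ∫ q in Ioc 0 L ×ˢ univ, vorticity f g q.1 q.2 * (g q.1 q.2 - q.2) * 1 =
      -∫ q in Ioc 0 L ×ˢ univ, q.2 * vorticity f g q.1 q.2 := by
    calc ∫ q in Ioc 0 L ×ˢ univ, vorticity f g q.1 q.2 * (g q.1 q.2 - q.2) * 1
        = ∫ q in Ioc 0 L ×ˢ univ, (vorticity f g q.1 q.2 * g q.1 q.2 - q.2 * vorticity f g q.1 q.2) :=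
          integral_congr_ae (Eventually.of_forall fun q => by simp only; ring)
      _ = (∫ q in Ioc 0 L ×ˢ univ, vorticity f g q.1 q.2 * g q.1 q.2) -
            ∫ q in Ioc 0 L ×ˢ univ, q.2 * vorticity f g q.1 q.2 := integral_sub i1 i2
      _ = -∫ q in Ioc 0 L ×ˢ univ, q.2 * vorticity f g q.1 q.2 := by
          rw [centroidLaw_integral_vorticity_mul_v hL hk hT hf hg hdiv hfper hgper, zero_sub]
  have key : Tendsto (fun R : ℝ => ∫ q in Ioc 0 L ×ˢ univ, vorticity f g q.1 q.2 * (g q.1 q.2 - q.2) *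
      deriv (fun y : ℝ => y * (Real.smoothTransition (2 - y / R) * Real.smoothTransition (2 + y / R))) q.2) atTop
      (𝓝 (∫ q in Ioc 0 L ×ˢ univ, vorticity f g q.1 q.2 * (g q.1 q.2 - q.2) * 1)) := by
    refine tendsto_integral_filter_of_dominated_convergence
      (fun q => (1 + 4 * Cσ) * (C * ((C + |q.2|) * Real.exp (-k * |q.2|)))) ?_ ?_ ?_ ?_
    · exact Eventually.of_forall fun R => ((cω.mul (cg.sub continuous_snd)).mul
        (((centroidLaw_weight_contDiff R).continuous_deriv le_rfl).comp continuous_snd)).aestronglyMeasurable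
    · filter_upwards [eventually_gt_atTop 0] with R hR
      exact Eventually.of_forall fun q => by rw [Real.norm_eq_abs]; exact centroidLaw_B_bound hk hT hR hCσ0 hCσ q
    · exact ((kato_integrableOn_weight' hk hC L).const_mul C).const_mul _
    · refine Eventually.of_forall fun q => tendsto_const_nhds.congr' ?_
      filter_upwards [centroidLaw_weight_eventually q.2] with R hR
      rw [hR.2]
  rw [e] at key
  exact key

/-- **`E_R = ∫∫ ∂_yω ψ_R′ → ∫∫ ∂_yω = 0`** as `R → ∞` (dominated convergence, `|∂_yω| ≤ Ce^{−k|y|}`). [folklore] -/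
theorem centroidLaw_limit_E (hk : 0 < k) (hT : SliceTails C k f g)
    (hf : ContDiff ℝ 2 (fun q : ℝ × ℝ => f q.1 q.2)) (hg : ContDiff ℝ 2 (fun q : ℝ × ℝ => g q.1 q.2))
    (hdiv : ∀ x y, dX f x y + dY g x y = 0) {Cσ : ℝ} (hCσ0 : 0 ≤ Cσ)
    (hCσ : ∀ x, |deriv Real.smoothTransition x| ≤ Cσ) :
    Tendsto (fun R : ℝ => ∫ q in Ioc 0 L ×ˢ univ, 1 * dY (vorticity f g) q.1 q.2 *
      deriv (fun y : ℝ => y * (Real.smoothTransition (2 - y / R) * Real.smoothTransition (2 + y / R))) q.2) atTop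
      (𝓝 0) := by
  have hC : 0 ≤ C := hT.nonneg
  have cωy : Continuous fun q : ℝ × ℝ => dY (vorticity f g) q.1 q.2 := continuous_dY (contDiff_one_vorticity hf hg)
  have e : ∫ q in Ioc 0 L ×ˢ univ, 1 * dY (vorticity f g) q.1 q.2 * 1 = 0 := by
    simp only [one_mul, mul_one]
    exact centroidLaw_integral_dY_vorticity hk hT hf hg hdiv
  have key : Tendsto (fun R : ℝ => ∫ q in Ioc 0 L ×ˢ univ, 1 * dY (vorticity f g) q.1 q.2 *
      deriv (fun y : ℝ => y * (Real.smoothTransition (2 - y / R) * Real.smoothTransition (2 + y / R))) q.2) atTop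
      (𝓝 (∫ q in Ioc 0 L ×ˢ univ, 1 * dY (vorticity f g) q.1 q.2 * 1)) := by
    refine tendsto_integral_filter_of_dominated_convergence
      (fun q => (1 + 4 * Cσ) * (C * Real.exp (-k * |q.2|))) ?_ ?_ ?_ ?_
    · exact Eventually.of_forall fun R => ((continuous_const.mul cωy).mul
        (((centroidLaw_weight_contDiff R).continuous_deriv le_rfl).comp continuous_snd)).aestronglyMeasurable
    · filter_upwards [eventually_gt_atTop 0] with R hR
      exact Eventually.of_forall fun q => by
        rw [Real.norm_eq_abs]; exact centroidLaw_E_bound hT hf hg hdiv hR hCσ0 hCσ q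
    · exact ((kato_integrableOn_weight hk L).const_mul C).const_mul _
    · refine Eventually.of_forall fun q => tendsto_const_nhds.congr' ?_
      filter_upwards [centroidLaw_weight_eventually q.2] with R hR
      rw [hR.2]
  rw [e] at key
  exact key

end Limits

/-! ## The registered tools sub-goal -/

/-- **Tools for `vorticity_centroid_law` (registered sub-goal `centroidLaw_sliceLimits`).** For a `C²` divergence-free
`L`-periodic slice with shear tails `SliceTails C k` (`L, k > 0`) and a bound `C_σ ≥ 0` of `|σ′|`, as `R → ∞`:
`∫∫ ωψ_R → ∫∫ yω`, `∫∫ ω(v − y)ψ_R′ → −∫∫ yω`, `∫∫ ∂_yω ψ_R′ → 0` (`ψ_R(y) = yσ(2 − y/R)σ(2 + y/R)`). [folklore] -/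
theorem centroidLaw_sliceLimits : ∀ (L C k Cσ : ℝ) (f g : ℝ → ℝ → ℝ), 0 < L → 0 < k → SliceTails C k f g →
    ContDiff ℝ 2 (fun q : ℝ × ℝ => f q.1 q.2) → ContDiff ℝ 2 (fun q : ℝ × ℝ => g q.1 q.2) →
    (∀ x y, dX f x y + dY g x y = 0) → (∀ x y, f (x + L) y = f x y) → (∀ x y, g (x + L) y = g x y) →
    0 ≤ Cσ → (∀ x, |deriv Real.smoothTransition x| ≤ Cσ) →
      Tendsto (fun R : ℝ => ∫ q in Ioc 0 L ×ˢ univ, vorticity f g q.1 q.2 *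
        (q.2 * (Real.smoothTransition (2 - q.2 / R) * Real.smoothTransition (2 + q.2 / R)))) atTop
        (𝓝 (∫ q in Ioc 0 L ×ˢ univ, q.2 * vorticity f g q.1 q.2)) ∧
      Tendsto (fun R : ℝ => ∫ q in Ioc 0 L ×ˢ univ, vorticity f g q.1 q.2 * (g q.1 q.2 - q.2) *
        deriv (fun y : ℝ => y * (Real.smoothTransition (2 - y / R) * Real.smoothTransition (2 + y / R))) q.2) atTop
        (𝓝 (-∫ q in Ioc 0 L ×ˢ univ, q.2 * vorticity f g q.1 q.2)) ∧
      Tendsto (fun R : ℝ => ∫ q in Ioc 0 L ×ˢ univ, 1 * dY (vorticity f g) q.1 q.2 *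
        deriv (fun y : ℝ => y * (Real.smoothTransition (2 - y / R) * Real.smoothTransition (2 + y / R))) q.2) atTop
        (𝓝 0) :=
  fun _ _ _ _ _ _ hL hk hT hf hg hdiv hfper hgper hCσ0 hCσ =>
    ⟨centroidLaw_limit_N hk hT hf hg, centroidLaw_limit_B hL hk hT hf hg hdiv hfper hgper hCσ0 hCσ,
      centroidLaw_limit_E hk hT hf hg hdiv hCσ0 hCσ⟩

end Summit.AnomalousDissipation.AnomalousDissipation.Theorems.StrainedLayerLaw.LogEnstrophyClock

end
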